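import Summits.SmoothPoincare4.SmoothPoincare4.Theorems.DottedCircleRasmussenDcrGapHelperHandlebodyChartModelHandlesRadialFlowAux
import Summits.SmoothPoincare4.SmoothPoincare4.Theorems.DottedCircleRasmussenDcrGapHelperHandlebodyChartModelHandlesInflateFlow

/-!
# Helper `helper_handlebodyChart_modelHandles` (M3: handle structure of the model dotted handlebody `D_k`)
# of line `mk_friends` for crux `DcrGap` — the cut-off radial flow, part 2: the flow
(item stmt-SmoothPoincare4-16128, route route-SmoothPoincare4-DottedCircleRasmussen)

**Registered piece `helper_handlebodyChart_modelHandles_radialFlow` of the model lemma M3.**  Fourth and last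
stage of the squeeze of part 2 of the data stub `helper_handlebodyChart_modelHandles_data`: the flow `θ` of the
cut-off radial field `V = -χ Ψ (z - z₀, 0)` on `ℝ⁴ = ℂ²` towards the base centre `z₀ = -20k i`, where
`Ψ = Π_j ψ(|z - c_j|²)` is the stall cutoff of the holes (`ψ = 0` below `(8/5)²`, `ψ = 1` beyond `(41/25)²`)
and `χ = φ(G_k)` on the quarter-guard zone (`φ = 1` below `193/200`, `φ = 0` above `97/100`), smooth and
supported in the compact part `{guard ≥ 1, G_k ≤ 97/100}` of `D_k` (`ModelHandles.exists_radial_flow`):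
the flow commutes with the rotations of the `w`-plane and fixes `w`; along the orbit of a point of
`D_k ∩ {G_k ≤ 24/25} ∩ {|w| ≤ 1/10}` with all hole terms `≥ 11/4` the shadow never enters a stall disc
`|z - c_j|² ≤ 64/25` (rest points), moves along its ray towards `z₀` as `z - z₀ = Λ(t) (z(0) - z₀)` with
`Λ` continuous, positive, `≤ 1`, non-increasing (`…ModelHandlesRadialFlowAux`), the level stays `≤ 193/200`
(zone estimates along rays, ibid.), so `χ = 1` along the orbit, and `Λ` decays exactly like `e^{-t}` across
every time interval during which the shadow is outside all the stall layers `|z - c_j|² < (41/25)²`.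

No definitions, no named facts, no `sorry`.  References: J. Milnor, *Morse Theory* (1963), §3
[Milnor1963]; J. M. Lee, *Introduction to Smooth Manifolds*, 2nd ed. (2012), Thm. 9.16
[LeeSmoothManifolds2013].
-/

-- the prescribed namespace `Summit.<P>.<Sub>.…` duplicates `SmoothPoincare4` (P = Sub)
set_option linter.dupNamespace false
set_option linter.style.longLine false

noncomputable section

open scoped Manifold ContDiff Topology ComplexConjugate
open Function Set Metric Filter
open Literature.Topology.FourManifolds Literature.Topology.FourManifolds.MMSW
open Literature.AlgebraicTopology.Homotopy.HopfFibration

namespace Summit.SmoothPoincare4.SmoothPoincare4.Theorems.DcrGap.MkFriends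

namespace ModelHandles

/-- **The cut-off radial flow towards the base centre** (see the module docstring). [folklore] -/
theorem exists_radial_flow (k : ℕ) :
    ∃ (θ : ℝ × EuclideanSpace ℝ (Fin 4) → EuclideanSpace ℝ (Fin 4))
      (V : EuclideanSpace ℝ (Fin 4) → EuclideanSpace ℝ (Fin 4)) (K : Set (EuclideanSpace ℝ (Fin 4))),
      ContDiff ℝ ∞ θ ∧ (∀ x, θ (0, x) = x) ∧ (∀ t s x, θ (t, θ (s, x)) = θ (t + s, x)) ∧
      (∀ x t, HasDerivAt (fun t => θ (t, x)) (V (θ (t, x))) t) ∧ Continuous V ∧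
      IsCompact K ∧ K ⊆ modelHandlebody k ∧ (∀ x, x ∉ K → V x = 0) ∧ (∀ x, x ∉ K → ∀ t, θ (t, x) = x) ∧
      (∀ s, ∃ Φ : EuclideanSpace ℝ (Fin 4) ≃ₘ⟮𝓡 4, 𝓡 4⟯ EuclideanSpace ℝ (Fin 4), ∀ x, Φ x = θ (s, x)) ∧
      (∀ u : ℂ, ‖u‖ = 1 → ∀ t x, θ (t, fibreRot (fun _ => u) x) = fibreRot (fun _ => u) (θ (t, x))) ∧
      (∀ x t, wC (θ (t, x)) = wC x) ∧
      ∀ x ∈ modelHandlebody k, levelFun k x ≤ 24 / 25 → ‖wC x‖ ≤ 1 / 10 →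
        (∀ j, (11 : ℝ) / 4 ≤ holeTerm k j x) →
        (∀ t, 0 ≤ t → θ (t, x) ∈ modelHandlebody k ∧ ∀ j, (64 : ℝ) / 25 < holeTerm k j (θ (t, x))) ∧
        ∃ Λ : ℝ → ℝ, Continuous Λ ∧ Λ 0 = 1 ∧ (∀ t, 0 ≤ t → 0 < Λ t ∧ Λ t ≤ 1) ∧ AntitoneOn Λ (Ici 0) ∧
          (∀ t, 0 ≤ t → zC (θ (t, x)) - Complex.mk 0 (-(20 * (k : ℝ))) =
            (Λ t : ℂ) * (zC x - Complex.mk 0 (-(20 * (k : ℝ))))) ∧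
          ∀ t₁ t₂, 0 ≤ t₁ → t₁ ≤ t₂ →
            (∀ t ∈ Icc t₁ t₂, ∀ j, (1681 : ℝ) / 625 ≤ holeTerm k j (θ (t, x))) →
              Λ t₂ = Λ t₁ * Real.exp (-(t₂ - t₁)) := by
  set z₀ : ℂ := Complex.mk 0 (-(20 * (k : ℝ))) with hz₀
  -- the cutoffs
  set φ : ℝ → ℝ := fun g => Real.smoothTransition (200 * (97 / 100 - g)) with hφ
  have hφs : ContDiff ℝ ∞ φ :=
    Real.smoothTransition.contDiff.comp (contDiff_const.mul (contDiff_const.sub contDiff_id))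
  have hφ1 : ∀ g, g ≤ 193 / 200 → φ g = 1 := fun g hg => Real.smoothTransition.one_of_one_le (by linarith)
  have hφ0 : ∀ g, φ g ≠ 0 → g < 97 / 100 := fun g hg => by
    by_contra hle; push Not at hle
    exact hg (Real.smoothTransition.zero_of_nonpos (by linarith))
  set ψ : ℝ → ℝ := fun s => Real.smoothTransition ((s - 64 / 25) * (625 / 81)) with hψ
  have hψs : ContDiff ℝ ∞ ψ :=
    Real.smoothTransition.contDiff.comp ((contDiff_id.sub contDiff_const).mul contDiff_const)
  have hψ1 : ∀ s, 1681 / 625 ≤ s → ψ s = 1 := fun s hs => Real.smoothTransition.one_of_one_le (by linarith)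
  have hψ0 : ∀ s, s ≤ 64 / 25 → ψ s = 0 := fun s hs => Real.smoothTransition.zero_of_nonpos (by nlinarith)
  have hψ01 : ∀ s, 0 ≤ ψ s ∧ ψ s ≤ 1 := fun s => ⟨Real.smoothTransition.nonneg _, Real.smoothTransition.le_one _⟩
  set Ψ : EuclideanSpace ℝ (Fin 4) → ℝ := fun y => ∏ j : Fin k, ψ (holeTerm k j y) with hΨ
  have hΨs : ContDiff ℝ ∞ Ψ := contDiff_prod fun j _ => hψs.comp (contDiff_holeTerm j)
  have hΨ01 : ∀ y, 0 ≤ Ψ y ∧ Ψ y ≤ 1 := fun y =>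
    ⟨Finset.prod_nonneg fun j _ => (hψ01 _).1, Finset.prod_le_one (fun j _ => (hψ01 _).1) fun j _ => (hψ01 _).2⟩
  have hΨ0 : ∀ y (j : Fin k), holeTerm k j y ≤ 64 / 25 → Ψ y = 0 := fun y j hj =>
    Finset.prod_eq_zero (Finset.mem_univ j) (hψ0 _ hj)
  have hΨ1 : ∀ y, (∀ j, (1681 : ℝ) / 625 ≤ holeTerm k j y) → Ψ y = 1 := fun y hy =>
    Finset.prod_eq_one fun j _ => hψ1 _ (hy j)
  set χ : EuclideanSpace ℝ (Fin 4) → ℝ :=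
    fun y => if ∀ j : Fin k, (1 : ℝ) / 4 < holeTerm k j y then φ (levelFun k y) else 0 with hχ
  have hpos4 : ∀ y : EuclideanSpace ℝ (Fin 4), (∀ j, (1 : ℝ) / 4 < holeTerm k j y) →
      ∀ j, 0 < holeTerm k j y := fun y h j => lt_trans (by norm_num) (h j)
  have hχne : ∀ y, χ y ≠ 0 → (∀ j, (1 : ℝ) / 4 < holeTerm k j y) ∧ levelFun k y < 97 / 100 := by
    intro y h
    simp only [hχ] at h
    split_ifs at h with h4
    · exact ⟨h4, hφ0 _ h⟩
    · exact absurd rfl h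
  have hχ01 : ∀ y, 0 ≤ χ y ∧ χ y ≤ 1 := by
    intro y
    simp only [hχ]
    split_ifs
    · exact ⟨Real.smoothTransition.nonneg _, Real.smoothTransition.le_one _⟩
    · exact ⟨le_rfl, zero_le_one⟩
  have hχeq : ∀ y, (∀ j, (1 : ℝ) / 4 < holeTerm k j y) → χ y = φ (levelFun k y) := fun y h => by
    simp only [hχ, if_pos h]
  have hχs : ContDiff ℝ ∞ χ := by
    rw [contDiff_iff_contDiffAt]
    intro y
    by_cases hy4 : ∀ j : Fin k, (1 : ℝ) / 4 < holeTerm k j y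
    · have hy0 : ∀ j, holeTerm k j y ≠ 0 := fun j => (hpos4 y hy4 j).ne'
      have hev : χ =ᶠ[𝓝 y] fun y' => φ (levelFun k y') := by
        filter_upwards [(isOpen_guard (1 / 4)).mem_nhds hy4] with y' hy'
        simp only [hχ, if_pos hy']
      exact (hφs.contDiffAt.comp y (contDiffAt_levelFun hy0)).congr_of_eventuallyEq hev
    · push Not at hy4
      obtain ⟨j, hj⟩ := hy4
      have hev : χ =ᶠ[𝓝 y] fun _ => 0 := by
        have hopen : IsOpen {y' : EuclideanSpace ℝ (Fin 4) | holeTerm k j y' < 1 / 2} :=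
          isOpen_lt (continuous_holeTerm j) continuous_const
        filter_upwards [hopen.mem_nhds (show holeTerm k j y < 1 / 2 by linarith)] with y' hy'
        by_contra h
        obtain ⟨h4, hG⟩ := hχne y' h
        have := FriendsH2.half_lt_holeTerm_of_levelFun_lt_two (hpos4 y' h4) (by linarith) j
        linarith
      exact (contDiffAt_const (c := (0 : ℝ))).congr_of_eventuallyEq hev
  -- the projection onto the `z`-plane and the lifted centre
  obtain ⟨P, hP⟩ := exists_clm_zProj
  set cpt : EuclideanSpace ℝ (Fin 4) := ofZW z₀ 0 with hcpt
  have hPsub : ∀ y, P (y - cpt) = ofZW (zC y - z₀) 0 := by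
    intro y
    rw [map_sub, hP, hP]
    ext i
    fin_cases i <;> simp [ofZW, zC, hcpt]
  -- the field and the support set
  set V : EuclideanSpace ℝ (Fin 4) → EuclideanSpace ℝ (Fin 4) :=
    fun y => (-(χ y * Ψ y)) • P (y - cpt) with hV
  set K : Set (EuclideanSpace ℝ (Fin 4)) := {y | (∀ j : Fin k, (1 : ℝ) ≤ holeTerm k j y) ∧
    levelFun k y ≤ 97 / 100} with hK
  have hKD : K ⊆ modelHandlebody k := fun y hy => ⟨hy.1, by linarith [hy.2]⟩
  have hχK : ∀ y, χ y ≠ 0 → y ∈ K := by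
    intro y hy
    obtain ⟨h4, hG⟩ := hχne y hy
    refine ⟨fun j => ?_, hG.le⟩
    have h := ((FriendsH2.levelFun_bounds (hpos4 y h4)).2.2 j).trans hG.le
    rw [div_le_iff₀ (hpos4 y h4 j)] at h
    nlinarith [hpos4 y h4 j]
  have hKc : IsCompact K := by
    have hKeq : K = {y : EuclideanSpace ℝ (Fin 4) | ∀ j : Fin k, (1 : ℝ) ≤ holeTerm k j y} ∩
        levelFun k ⁻¹' Iic (97 / 100) := rfl
    refine Metric.isCompact_of_isClosed_isBounded ?_ ?_
    · rw [hKeq]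
      exact (continuousOn_levelFun (by norm_num : (0 : ℝ) < 1)).preimage_isClosed_of_isClosed
        (isClosed_guard 1) isClosed_Iic
    · refine (isBounded_closedBall (x := (0 : EuclideanSpace ℝ (Fin 4)))
        (r := 40 * ((k : ℝ) + 1) + 1)).subset fun y hy => mem_closedBall_zero_iff.2 ?_
      have hpos : ∀ j, 0 < holeTerm k j y := fun j => lt_of_lt_of_le (by norm_num) (hy.1 j)
      have h1 := FriendsH2.norm_sq_le_levelFun hpos
      have h5 : ‖y‖ ^ 2 ≤ (40 * ((k : ℝ) + 1) + 1) ^ 2 := by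
        have h2 : levelFun k y * ((40 * ((k : ℝ) + 1)) ^ 2 + 1) ≤ 1 * ((40 * ((k : ℝ) + 1)) ^ 2 + 1) :=
          mul_le_mul_of_nonneg_right (by linarith [hy.2]) (by positivity)
        have hk : (0 : ℝ) ≤ k := k.cast_nonneg
        nlinarith
      exact le_of_pow_le_pow_left₀ two_ne_zero (by positivity) h5
  -- smoothness and support of the field
  have hVs : ContDiff ℝ ∞ V :=
    (hχs.mul hΨs).neg.smul (P.contDiff.comp (contDiff_id.sub contDiff_const))
  have hVK : ∀ y, y ∉ K → V y = 0 := by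
    intro y hy
    have hχ0 : χ y = 0 := by by_contra h; exact hy (hχK y h)
    simp only [hV, hχ0, zero_mul, neg_zero, zero_smul]
  have hVzero : ∀ y (j : Fin k), holeTerm k j y ≤ 64 / 25 → V y = 0 := by
    intro y j hj
    simp only [hV, hΨ0 y j hj, mul_zero, neg_zero, zero_smul]
  -- equivariance under the rotations of the `w`-plane
  have hrotfix : ∀ (u : ℂ) (z : ℂ), fibreRot (fun _ => u) (ofZW z 0) = ofZW z 0 := by
    intro u z; simp [fibreRot]
  have hVrot : ∀ u : ℂ, ‖u‖ = 1 → ∀ (L : EuclideanSpace ℝ (Fin 4) →L[ℝ] EuclideanSpace ℝ (Fin 4)),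
      (∀ y, L y = fibreRot (fun _ => u) y) → ∀ y, V (L y) = L (V y) := by
    intro u hu L hL y
    have hT : ∀ j, holeTerm k j (L y) = holeTerm k j y := fun j => by
      rw [hL]; exact holeTerm_fibreRot _ j y
    have hGy : levelFun k (L y) = levelFun k y := by
      rw [hL]; exact levelFun_fibreRot (by simpa using hu)
    have hχy : χ (L y) = χ y := by simp only [hχ, hT, hGy]
    have hΨy : Ψ (L y) = Ψ y := by simp only [hΨ, hT]
    have hPy : P (L y - cpt) = P (y - cpt) := by rw [hPsub, hPsub, hL, zC_fibreRot]
    have hLP : L (P (y - cpt)) = P (y - cpt) := by rw [hPsub, hL, hrotfix]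
    simp only [hV, hχy, hΨy, hPy, map_smul, hLP]
  -- the flow package
  obtain ⟨θ, hθs, h0, hadd, hint, hfix, hfixK, hstage, hcomm⟩ := exists_flow_package hVs hKc hVK
  have horbK : ∀ x ∈ K, ∀ t, θ (t, x) ∈ K := by
    intro x hxK t
    by_contra h
    have h1 := hfixK _ h (-t)
    rw [hadd, neg_add_cancel, h0] at h1
    exact h (h1 ▸ hxK)
  have hbar : ∀ x t, V (θ (t, x)) = 0 → θ (t, x) = x := by
    intro x t h
    have h1 := hfix _ h (-t)
    rw [hadd, neg_add_cancel, h0] at h1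
    exact h1.symm
  -- `w` is constant along the flow
  obtain ⟨Lw, hLw⟩ := exists_clm_wC
  have hwV : ∀ y, wC (V y) = 0 := by
    intro y
    rw [show wC (V y) = Lw (V y) from (hLw _).symm]
    simp only [hV, map_smul]
    rw [hLw, hPsub, wC_ofZW, smul_zero]
  have hwconst : ∀ x t, wC (θ (t, x)) = wC x := by
    intro x t
    have hd : ∀ s, HasDerivAt (fun s => wC (θ (s, x))) 0 s := fun s => by
      have := hasDerivAt_wC_flow hint x s; rwa [hwV] at this
    have h := is_const_of_deriv_eq_zero (fun s => (hd s).differentiableAt) (fun s => (hd s).deriv) t 0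
    simpa [h0] using h
  -- the shadow of the field
  obtain ⟨Lz, hLz⟩ := exists_clm_zC
  have hzV : ∀ y, zC (V y) = -((χ y * Ψ y : ℝ) : ℂ) * (zC y - z₀) := by
    intro y
    rw [show zC (V y) = Lz (V y) from (hLz _).symm]
    simp only [hV, map_smul]
    rw [hLz, hPsub, zC_ofZW, Complex.real_smul]
    push_cast
    ring
  refine ⟨θ, V, K, hθs, h0, hadd, hint, hVs.continuous, hKc, hKD, hVK, hfixK, fun s => ?_,
    fun u hu t x => ?_, hwconst, fun x hx hG hwx hhole => ?_⟩
  · obtain ⟨Φ, hΦ⟩ := hstage s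
    exact ⟨Φ, hΦ⟩
  · obtain ⟨L, hL⟩ := exists_clm_fibreRot_const u
    rw [← hL, ← hL]
    exact hcomm L (hVrot u hu L hL) _ _
  -- the orbit of a point of `D_k ∩ {G_k ≤ 24/25} ∩ {|w| ≤ 1/10}` beyond the stall layers
  have hxK : x ∈ K := ⟨hx.1, by linarith⟩
  have horb : ∀ t, θ (t, x) ∈ K := horbK x hxK
  -- the stall discs are never entered
  have hfar : ∀ t j, (64 : ℝ) / 25 < holeTerm k j (θ (t, x)) := by
    intro t j
    by_contra hle
    push Not at hle
    have h := hbar x t (hVzero _ j hle)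
    rw [h] at hle
    linarith [hhole j]
  -- the linear equation of the shadow offset
  set b : ℝ → ℝ := fun t => χ (θ (t, x)) * Ψ (θ (t, x)) with hb
  have hb0 : ∀ t, 0 ≤ b t := fun t => mul_nonneg (hχ01 _).1 (hΨ01 _).1
  have hb1 : ∀ t, b t ≤ 1 := fun t => mul_le_one₀ (hχ01 _).2 (hΨ01 _).1 (hΨ01 _).2
  have hq : ∀ t, HasDerivAt (fun t => zC (θ (t, x)) - z₀) (-(b t : ℂ) * (zC (θ (t, x)) - z₀)) t := by
    intro t
    have h := (hasDerivAt_zC_flow hint x t).sub_const z₀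
    rw [hzV] at h
    exact h
  obtain ⟨Λ, hΛc, hΛ0, hΛ01, hΛanti, hΛq, hΛexp⟩ := radial_ode hq hb0 hb1
  simp only [h0] at hΛq
  -- the level stays `≤ 193/200`, so `χ = 1` along the orbit
  have hGt : ∀ t, 0 ≤ t → levelFun k (θ (t, x)) ≤ 193 / 200 := fun t ht =>
    levelFun_le_of_ray k hG (hwconst x t) hwx (fun j => (hfar t j).le) (hΛ01 t ht).1.le (hΛ01 t ht).2
      (hΛq t ht)
  have hχ1 : ∀ t, 0 ≤ t → χ (θ (t, x)) = 1 := fun t ht => by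
    rw [hχeq _ (fun j => by linarith [(horb t).1 j])]; exact hφ1 _ (hGt t ht)
  refine ⟨fun t ht => ⟨⟨(horb t).1, by linarith [hGt t ht]⟩, hfar t⟩, Λ, hΛc, hΛ0, hΛ01, hΛanti, hΛq,
    fun t₁ t₂ ht₁ ht₁₂ hout => hΛexp t₁ t₂ ht₁ ht₁₂ fun t ht => ?_⟩
  simp only [hb]
  rw [hχ1 t (ht₁.trans ht.1), hΨ1 _ (hout t ht), mul_one]

end ModelHandles

/-- **Registered piece `helper_handlebodyChart_modelHandles_radialFlow` of the model lemma M3 (the cut-off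
radial flow towards the base centre)**: `ModelHandles.exists_radial_flow`, fully quantified. [folklore] -/
theorem helper_handlebodyChart_modelHandles_radialFlow : ∀ (k : ℕ), ∃ (θ : ℝ × EuclideanSpace ℝ (Fin 4) → EuclideanSpace ℝ (Fin 4)) (V : EuclideanSpace ℝ (Fin 4) → EuclideanSpace ℝ (Fin 4)) (K : Set (EuclideanSpace ℝ (Fin 4))), ContDiff ℝ ((⊤ : ℕ∞) : WithTop ℕ∞) θ ∧ (∀ x, θ (0, x) = x) ∧ (∀ t s x, θ (t, θ (s, x)) = θ (t + s, x)) ∧ (∀ x t, HasDerivAt (fun t => θ (t, x)) (V (θ (t, x))) t) ∧ Continuous V ∧ IsCompact K ∧ K ⊆ Literature.Topology.FourManifolds.MMSW.modelHandlebody k ∧ (∀ x, x ∉ K → V x = 0) ∧ (∀ x, x ∉ K → ∀ t, θ (t, x) = x) ∧ (∀ s, ∃ Φ : EuclideanSpace ℝ (Fin 4) ≃ₘ⟮𝓡 4, 𝓡 4⟯ EuclideanSpace ℝ (Fin 4), ∀ x, Φ x = θ (s, x)) ∧ (∀ u : ℂ, ‖u‖ = 1 → ∀ t x, θ (t, Literature.Topology.FourManifolds.MMSW.fibreRot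 (fun _ => u) x) = Literature.Topology.FourManifolds.MMSW.fibreRot (fun _ => u) (θ (t, x))) ∧ (∀ x t, Literature.AlgebraicTopology.Homotopy.HopfFibration.wC (θ (t, x)) = Literature.AlgebraicTopology.Homotopy.HopfFibration.wC x) ∧ ∀ x ∈ Literature.Topology.FourManifolds.MMSW.modelHandlebody k, Literature.Topology.FourManifolds.MMSW.levelFun k x ≤ 24 / 25 → ‖Literature.AlgebraicTopology.Homotopy.HopfFibration.wC x‖ ≤ 1 / 10 → (∀ j, (11 : ℝ) / 4 ≤ Literature.Topology.FourManifolds.MMSW.holeTerm k j x) → (∀ t : ℝ, 0 ≤ t → θ (t, x) ∈ Literature.Topology.FourManifolds.MMSW.modelHandlebody k ∧ ∀ j, (64 : ℝ) / 25 < Literature.Topology.FourManifolds.MMSW.holeTerm k j (θ (t, x))) ∧ ∃ Λ : ℝ → ℝ, Continuous Λ ∧ Λ 0 = 1 ∧ (∀ t : ℝ, 0 ≤ t → 0 < Λ t ∧ Λ t ≤ 1) ∧ AntitoneOn Λ (Set.Ici 0) ∧ (∀ t : ℝ, 0 ≤ t → Literature.AlgebraicTopology.Homotopy.HopfFibration.zC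 (θ (t, x)) - Complex.mk 0 (-(20 * (k : ℝ))) = (Λ t : ℂ) * (Literature.AlgebraicTopology.Homotopy.HopfFibration.zC x - Complex.mk 0 (-(20 * (k : ℝ))))) ∧ ∀ t₁ t₂ : ℝ, 0 ≤ t₁ → t₁ ≤ t₂ → (∀ t ∈ Set.Icc t₁ t₂, ∀ j, (1681 : ℝ) / 625 ≤ Literature.Topology.FourManifolds.MMSW.holeTerm k j (θ (t, x))) → Λ t₂ = Λ t₁ * Real.exp (-(t₂ - t₁)) :=
  fun k => ModelHandles.exists_radial_flow k

end Summit.SmoothPoincare4.SmoothPoincare4.Theorems.DcrGap.MkFriends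

end
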